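import Literature.NumberTheory.EllipticCurves.Delbourgo2002.PAdicBSDLeadingTerm
import Literature.NumberTheory.EllipticCurves.PAdicLFunction
import Mathlib.NumberTheory.Padics.Complex
import HarnessLib

/-!
# Delbourgo 2002, Theorem (C): the RATIONAL divisibility `L_p^{alg} ∣ (L_p^{an})^Δ` at an additive,
# potentially ORDINARY prime `p ≥ 5` (named fact; the analytic branch in E-normalised interpolation form)

Topic `NumberTheory/EllipticCurves`, sub-directory `Delbourgo2002` (namespace = path). ONE named fact
(`thmC_charIdeal_dvd_tameBranch`, a `def … : Prop`, D-0014; nothing asserted, no `_holds` — size L: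
Kato's Euler system, Perrin-Riou theory for the non-crystalline representation), sibling of
`Delbourgo2002.mainTheorem` (= Theorem (A)+(B), same paper, same hypotheses; file
`PAdicBSDLeadingTerm.lean`, whose module docstring transcribes pp. 38–40 and records "(C) … not
transcribed: no tree object"). Written for the residual cell `b2b-bsdres` (sub-cell additive-p2 =
X3♯(G-ord)/X4♯(G-ord), gen 20), where the Summits-side typed input
`Summit.BirchSwinnertonDyer.Rank1Residual.Additive.TameBranchRatDvdAt` (file
`Additive/TameBranchKatoDivisibility.lean`) is EXACTLY this statement in the cell's vocabulary; the
object that was missing in gen 18 — the analytic branch — is supplied here by an INTERPOLATION PACKAGE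
in the tree's modular-symbol vocabulary (`ratPlusSymbol`, `ratTwistedSymbolSum`, `cyclotomicGenerator`:
the shape of `IsPAdicLFunctionOf`, Mazur–Tate–Teitelbaum (14.3)), inlined in the statement.

## The printed statements (J. Number Theory 95 (2002) 38–71; held text
`paper:delbourgo2002-p-adic-birch-swinnerton-dyer-conjecture-non`, journal page = text page + 37)

* p. 38: "Let `E` be a modular elliptic curve defined over the rationals without complex
  multiplication." p. 39, **Hypothesis**: "Either `E` is potentially ordinary at `p ≥ 5`; or `E` is
  potentially ordinary at `p = 3` with semistable reduction over a quadratic extension of `ℚ₃`."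
  p. 39: "It can be deduced from this Hypothesis that there exists a character `ε` of conductor `p`
  such that `Frob_p⁻¹ ∈ G_{ℚ_p}/I_p` has unit eigenvalue '`a`' on the subspace of
  `H¹_ét(E ×_ℚ ℚ̄, ℚ_l) ⊗ ε⁻¹` fixed by the inertia group `I_p` at any prime `l ≠ p` … Moreover by
  [De, Theorems 1,2] there is a unique element `L_p^{an} ∈ ℤ_p⟦G × Δ⟧[μ_p, p⁻¹]` satisfying for all
  characters `χ ≠ ε` of `p`-power conductor
  `χ(L_p^{an}) = p^m / (a^m ∑_{n=1}^{p^m} χ⁻¹ε(n) exp(2πin/p^m)) × L(E, χ⁻¹, 1)/Ω_E^{sign(χ)}`, where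
  `m = ord_p(cond(χε⁻¹))` and we consider the right-hand side `p`-adically via a fixed embedding of `ℚ̄`
  into `ℚ̄_p`. Here `Ω⁺_E` (resp. `Ω⁻_E`) denote the real (resp. imaginary) period for a Néron
  differential associated to a minimal Weierstrass equation for `E` over `ℤ`."
  (`G = Gal(F_∞/ℚ) ≅ ℤ_p`, `F_∞` the cyclotomic `ℤ_p`-extension; `Δ = Gal(ℚ(μ_p)/ℚ)`.)
* p. 40, **Theorem.** "Assume that `E` satisfies the Hypothesis. Then (A) The Iwasawa module
  `Sel(E/F_∞)^` is `ℤ_p⟦G⟧`-torsion. (B) Let `L_p^{alg}` denote a generator of the characteristic ideal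
  of `Sel(E/F_∞)^` … **(C) The power series `L_p^{alg}` divides in `ℤ_p⟦G⟧[μ_p, p⁻¹]` the branch of
  `L_p^{an}` fixed by `Δ`.** (D) We have the inequality: `order_{s=0} κ^s(L_p^{an}) ≥ r_E`." p. 40:
  "Clearly, (B) and (C) together will imply (D)."
* p. 58, §3, "Proof of Theorem (A), (C). From now on assume that `E` has no complex multiplication …
  by a theorem of Serre [Se], `ρ_{E,p}(G_ℚ)` is open in `GL₂(ℤ_p)` … Rohrlich's Theorem [Ro] implies
  that the values `L(E, χ⁻¹, 1)` are non-zero for almost all `χ ∈ X(G)_{tors}`, so applying Proposition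
  2.3 we see that the element `(c_{p^m})^Δ_m := (p−1)⁻¹ Tr_Δ(c_{p^m})_m` is not `ℤ_p⟦G⟧`-torsion. …
  the conditions of [Ka2, Ru2, PR2] are met"; p. 59: "`char.ideal(H²_{0,S}(T_pE))·p^m ⊇
  char.ideal(H¹_S(T_pE)/ℤ_p⟦G⟧·(c_{p^m})^Δ_m)`, where `p^m ∈ p^{ℕ₀}` depends on the image of the Galois
  group in `Aut(T_pE)` … in the additive reduction case there are infinitely many examples with
  `Coker(ρ_{E,p})` non-trivial"; p. 60: "`ℤ_p⟦G⟧[μ_p]·L_p^{alg}` contains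
  `p^m L∘loc_p(c_{p^m})^Δ_m = p^m C⁺_E (L_p^{an})^Δ`, which is enough to prove Theorem (A), (C)."
  Bibliography p. 71: `[De]` = Delbourgo, Compositio Math. 113 (1998); `[Ka2]` = Kato, *Euler systems,
  Iwasawa theory and Selmer groups* ("preprint"; = Kodai Math. J. 22 (1999)); `[Ka3]` = Kato,
  Astérisque 295 (2004) (p. 54: "Kato's Theorem [Ka3, Thm. 9.6]", with `[Ka1]` at `p ∣ cond E`);
  `[Ru2]` = Rubin, *Euler systems*; `[PR2]` = Perrin-Riou, Ann. Inst. Fourier 48 (1998); `[KKT]` =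
  Kato–Kurihara–Tsuji "in preparation" (used p. 46 for the interpolating homomorphisms of §1, which
  feed Prop. 2.3 and hence BOTH (A) and (C); Delbourgo names an alternative route via [PR1]) — flag
  `Del02-KKT-inprep`, the SAME dependency set as the accepted sibling `mainTheorem` (A)+(B).

## The transcription (scope, object, faithfulness)

* SCOPE: the first bullet of the Hypothesis only — `p ≥ 5`, `E` additive at `p`, NO complex
  multiplication, and EITHER potentially good ORDINARY in the global (G)-ordinary form of
  `mainTheorem` (a `p`-th cyclotomic field `L ⊇ ℚ` and an intermediate field `F` over which `E_F` is good
  with unit root at every place above `p`; at `p ≥ 5` EQUIVALENT to "potentially good ordinary at `p`",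
  cell theorem `typeGOrd_iff_exists_good_unitRoot`) OR potentially multiplicative in the form of
  `mainTheorem_potMult` (`ord_p j_E < 0` and a quadratic twist multiplicative at `p`).
  `-- TODO(general form): the case p = 3 of the Hypothesis (tame defect 2 at 3) is not transcribed.`
* THE ALGEBRAIC SIDE: as in `mainTheorem` — the cyclotomic `ℤ_p`-extension `κ` with a topological
  generator `γ` matching the cyclotomic variable (`IsCyclotomicVariable p γ`: `T ↔ γ − 1`,
  `κ(γ) ↔ 1 + p = cyclotomicGenerator p`), a Pontryagin-dual datum `D : W.SelmerDualData κ γ` of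
  `Sel_{p^∞}(E/ℚ_∞)` (Delbourgo's `Sel(E/F_∞)^`), `D.charIdeal` its characteristic ideal in
  `Λ = ℤ_p⟦T⟧`, `ι = iwasawaToPowerSeries p : Λ ↪ ℚ_p⟦T⟧`.
* THE ANALYTIC SIDE — the Δ-fixed branch in E-NORMALISED form. Print evaluates `(L_p^{an})^Δ` at the
  characters `κ` of `G`, i.e. the even Dirichlet characters of `p`-power order and conductor `p^m`,
  `m ≥ 2` (and `κ = 1`, `m = ord_p cond(ε⁻¹) = 1`): `κ((L_p^{an})^Δ) = a^{−m} p^m G(κ̄ε)⁻¹ L(E,κ̄,1)/Ω⁺_E`,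
  `G` the Gauss sum against `n ↦ exp(2πin/p^m)`. By Birch's formula (tree:
  `ratTwistedSymbolSum_mul_plusPeriod`, MTT §I.8 (8.6)) `∑_{b mod p^m} κ(b)[b/p^m]⁺_f = G(κ)·L(E,κ̄,1)/Ω⁺_f`
  for the newform `f` of `E` (`[·]⁺_f = ratPlusSymbol f`, `Ω⁺_f` the newform period, `Ω⁺_f/Ω⁺_E ∈ ℚ^×`),
  and by the elementary Gauss–Jacobi identity **`τ(ε,ψ_κ)·G(κ)·G(ε̄) = p·G(κε̄)`** for `κ` primitive of
  conductor `p^m`, `m ≥ 2`, where `τ(ε,ψ_κ) := ∑_{t mod p} ε(t)κ(1 + t p^{m−1})` is the "intrinsic" Gauss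
  sum of `ε` against the additive character of `ℤ/p` cut out by `κ` (equivalently: the Jacobi sum
  `J(κ, ε̄) = p/τ(ε,ψ_κ)`; checked numerically by the transcribing seat for
  `(p,e) ∈ {(5,2),(5,4),(7,2),(7,3),(7,6),(11,2),(13,2),(13,3),(13,4),(13,6)}`, `m ∈ {2,3}`, to `10⁻¹²` —
  flag `Del02-ThmC-GaussJacobi` until a kernel proof is filed), together with `G(χ)G(χ̄) = χ(−1)p^m`,
  the values of the power series
  `B_E := c · (L_p^{an})^Δ`, `c := ε(−1)·G(ε̄)⁻¹·Ω⁺_E/Ω⁺_f ∈ ℚ_p(μ_p)^×` (ONE constant), are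
  `B_E(κ(γ) − 1) = a^{−m} · p⁻¹ · τ(ε,ψ_κ) · ∑_{b mod p^m} κ(b)[b/p^m]⁺_f` at every such `κ` AND
  `B_E(0) = a⁻¹ · [0]⁺_f` at the trivial character (`m = 1`: `p·G(ε)⁻¹ = ε(−1)G(ε̄)⁻¹·…`, same `c`).
  These values are `Gal(ℚ_p(μ_{p^∞})/ℚ_p)`-equivariant (`ε` takes values in `μ_e ⊂ ℤ_p^×` since
  `e ∣ p − 1`), and `B_E ∈ ℚ_p⟦T⟧` (the Mellin transform of the `χ̄`-twisted Mazur–Tate–Teitelbaum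
  measure of `f`'s `p`-ordinary twist; cell theorem `exists_isTameBranchOf_of_hasOrdinaryTwistPartner`).
  A BOUNDED power series with coefficients in a finite extension of `ℚ_p` is determined by its values at
  the points `ζ − 1`, `ζ ∈ μ_{p^∞}` of level `≥ 2` (Weierstrass preparation: finitely many zeros in the
  open disc). Hence the three clauses below — `B` bounded; `B(0) = a⁻¹[0]⁺_f`; the interpolation at
  every wild even `κ` — PIN `B = B_E = c·(L_p^{an})^Δ` for Delbourgo's pair `(ε, a)`, and (C) reads:
  `L_p^{alg} · h = (L_p^{an})^Δ` with `h ∈ ℤ_p[μ_p]⟦T⟧[p⁻¹]`, so `L_p^{alg} · (p^k c h) = p^k B_E` with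
  `p^k c h ∈ ℤ_p[μ_p]⟦T⟧` having `ℚ_p`-coefficients (the quotient of `p^k B_E ∈ ℚ_p⟦T⟧` by
  `0 ≠ L_p^{alg} ∈ ℤ_p⟦T⟧` is unique and Galois-invariant): **`p^k · B_E ∈ ι(char_Λ X(E/ℚ_∞))` for some
  `k ∈ ℕ`** — the conclusion below. (The Summits-side predicate
  `Summit.….Additive.IsTameBranchOf f p ε a B` of the cell's seat cc-typer-2 is these three clauses
  verbatim; its `tameGaussSum` is the inlined sum.)
* THE PAIR `(ε, a)`. Print: `ε` = the conductor-`p` character with a UNIT Frobenius eigenvalue `a` on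
  the `I_p`-fixed part of `V ⊗ ε⁻¹` — i.e. `f ⊗ ε̄` is the `p`-ORDINARY twist, `a = ã_p` its
  `U_p`-eigenvalue (Delbourgo 1998 §1.5: `f̃`); `ε` has exact order `e` = the tame defect (`#Φ_p`:
  `12/gcd(12, v_pΔ_min) ∈ {2,3,4,6}` in the potentially good case, `2` in the potentially multiplicative
  case; Delbourgo 1998 §1.5). The statement below quantifies over EVERY character `ε` mod `p` of that
  exact order (values in `ℂ_p`) and EVERY unit `a ∈ ℚ_p`; this says NO MORE than print, because a wrong
  pair admits NO bounded witness `B ∈ ℚ_p⟦T⟧` of the package (flag `Del02-ThmC-tuple-robustness`,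
  argument of the transcribing seat, elementary): among the `φ(e) ≤ 2` characters of order `e` the wrong
  one is `ε̄` (`e ≥ 3`); if `B̃` were a bounded witness for `(ε', a')` then, `B_E ≠ 0` (Rohrlich) being
  one for `(ε, a)`, the ratio of prescribed values at `κ` is `r(κ) = (a/a')^m·τ(ε',ψ_κ)/τ(ε,ψ_κ)`, and
  since `ψ_{κ'^p} = ψ_{κ'}` for `κ'` of level `m + 1 ≥ 3`, the bounded series
  `F(T) := B̃(T)·B_E((1+T)^p − 1) − (a/a')·B_E(T)·B̃((1+T)^p − 1) ∈ ℚ_p⟦T⟧` vanishes at every `ζ − 1` of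
  level `≥ 3`, so `F = 0`; comparing lowest-order terms at `T = 0` gives `a' = a` and then, coefficient
  by coefficient, `B̃/B_E` CONSTANT — whereas for `ε' = ε̄`, `e ≥ 3`, `r(κ) ∝ ε(c_κ)²`
  (`τ(ε,ψ_κ) = ε̄(c_κ)τ(ε,ψ)`, `ψ_κ = ψ(c_κ·)`) is not constant. So wrong pairs are VACUOUS rows.
* NOT in the statement: (A) (it is `mainTheorem`/`mainTheorem_potMult` (A)); `μ` (the divisibility
  is RATIONAL: it bounds `λ(char_Λ X) ≤ λ(B_E)` and nothing else); `p = 3`.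

## References
* D. Delbourgo, J. Number Theory 95 (2002) 38–71: Hypothesis, `L_p^{an}` (p. 39), Theorem (A)–(D)
  (p. 40), §3 pp. 58–60, bibliography p. 71. [Delbourgo2002]
* D. Delbourgo, Compositio Math. 113 (1998) 123–154, §1.5–1.6, Thm. 1, 2, p. 132. [Delbourgo1998]
* B. Mazur, J. Tate, J. Teitelbaum, Invent. Math. 84 (1986), §I.8 (8.6), §I.13–I.14. [MazurTateTeitelbaum1986Invent]
* K. Kato, Astérisque 295 (2004). [Kato2004Asterisque]
-/

noncomputable section

open scoped Classical NumberField MatrixGroups ModularForm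

open IsDedekindDomain NumberField WeierstrassCurve CongruenceSubgroup
  Literature.NumberTheory.EllipticCurves.ModularForms

namespace Literature.NumberTheory.EllipticCurves.Delbourgo2002

/-- **Delbourgo 2002, Theorem (C) — the rational divisibility `L_p^{alg} ∣ (L_p^{an})^Δ` — at an
ADDITIVE potentially ORDINARY prime `p ≥ 5` of a non-CM elliptic curve, with the Δ-fixed analytic
branch in E-normalised interpolation form.** Let `W/ℚ` be globally minimal WITHOUT complex
multiplication, `p ≥ 5` a prime of additive reduction at which `E` is EITHER potentially good ordinary
(global (G)-ordinary form, as in `mainTheorem`) OR potentially multiplicative (as in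
`mainTheorem_potMult`: `ord_p j_E < 0` and a quadratic twist multiplicative at `p`); `κ` the cyclotomic
`ℤ_p`-extension with a topological generator `γ` matching the cyclotomic variable; `f` the newform of
`W`. Then for EVERY Dirichlet character `ε` mod `p` (values in `ℂ_p`) of exact order `e` — `e = 2` if
`ord_p j_E < 0`, else `e = 12/gcd(12, v_p Δ_min)` —, EVERY unit `a ∈ ℚ_p` and EVERY `B ∈ ℚ_p⟦T⟧` that is
BOUNDED, has `B(0) = a⁻¹·[0]⁺_f`, and satisfies for every `m ≥ 2` and every primitive even Dirichlet
character `κ` of conductor `p^m` and `p`-power order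
`B(κ(γ₀) − 1) = a^{−m}·p⁻¹·(∑_{t mod p} ε(t)κ(1 + t p^{m−1}))·∑_{b mod p^m} κ(b)[b/p^m]⁺_f`
(`γ₀ = cyclotomicGenerator p = 1 + p`, `[·]⁺_f = ratPlusSymbol f`; these clauses pin
`B = ε(−1)G(ε̄)⁻¹(Ω⁺_E/Ω⁺_f)·(L_p^{an})^Δ` for Delbourgo's pair and are vacuous otherwise — module
docstring): for every Pontryagin-dual datum `D` of `Sel_{p^∞}(E/ℚ_∞)`, **`ι g = p^k · B` for some
`g ∈ char_Λ X(E/ℚ_∞)` and some `k ∈ ℕ`** — print: "(C) The power series `L_p^{alg}` divides in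
`ℤ_p⟦G⟧[μ_p, p⁻¹]` the branch of `L_p^{an}` fixed by `Δ`" (p. 40; proof pp. 58–60 from Kato's Euler
system, Serre's open image and Rohrlich's non-vanishing — NO hypothesis on the image of `ρ_{E,p}`).
Weaker than print (`p = 3` omitted; (A), (B), (D) are the siblings / consequences). Flags for the
referee: `Del02-KKT-inprep` (proof dependency shared with `mainTheorem`), `Del02-ThmC-GaussJacobi`
(the E-normalisation constant; elementary identity, numerically verified, kernel proof owed),
`Del02-ThmC-tuple-robustness` (universal quantification over `(ε, a)`; elementary argument in the
module docstring). No `_holds`.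
[cite: Delbourgo2002, Theorem (C) (p. 40), Hypothesis and L_p^an (p. 39), §3 pp. 58–60]
[cite: Delbourgo1998, §1.5–1.6, Thm. 1–2 (the analytic element), p. 132]
[cite: MazurTateTeitelbaum1986Invent, §I.8 (8.6), §I.13–I.14 (interpolation shape)] -/
def thmC_charIdeal_dvd_tameBranch : Prop :=
  ∀ (W : WeierstrassCurve ℚ) [W.IsElliptic] [W.IsGloballyMinimal] (p : ℕ) [Fact p.Prime],
    5 ≤ p → ¬ W.HasCM →
    (¬ W.HasGoodReductionAtPrime p ∧ ¬ W.HasMultiplicativeReductionAtPrime p) →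
    ((∃ (L : Type) (_ : Field L) (_ : NumberField L) (_ : IsCyclotomicExtension {p} ℚ L)
        (F : IntermediateField ℚ L),
        ∀ w : HeightOneSpectrum (𝓞 F), (p : 𝓞 F) ∈ w.asIdeal →
          (W.baseChange F).HasGoodReductionAt w ∧ (W.baseChange F).HasUnitRootAt w) ∨
      (padicValRat p W.j < 0 ∧
        ∃ d : ℚ, d ≠ 0 ∧ (W.quadraticTwist d).HasMultiplicativeReductionAtPrime p)) →
    ∀ {κ : ZpExtension ℚ p} {γ : Field.absoluteGaloisGroup ℚ},
      κ.IsCyclotomic → κ.IsTopGenerator γ → IsCyclotomicVariable p γ →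
    ∀ {N : ℕ} [NeZero N] (f : CuspForm (Gamma0 N) 2), IsNewformOf W f →
    ∀ (ε : DirichletCharacter ℂ_[p] p) (a : ℚ_[p]) (B : PowerSeries ℚ_[p]),
      orderOf ε = (if padicValRat p W.j < 0 then 2
        else 12 / Nat.gcd 12 (padicValInt p W.minimalDiscriminantInt)) →
      ‖a‖ = 1 →
      (∃ C : ℝ, ∀ n : ℕ, ‖PowerSeries.coeff n B‖ ≤ C) →
      PowerSeries.constantCoeff B = a⁻¹ * (ratPlusSymbol f 0 : ℚ_[p]) →
      (∀ (m : ℕ), 2 ≤ m → ∀ χ : DirichletCharacter ℂ_[p] (p ^ m), χ.IsPrimitive → χ.Even →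
        (∃ j : ℕ, orderOf χ = p ^ j) →
          HasSum (fun k : ℕ ↦ algebraMap ℚ_[p] ℂ_[p] (PowerSeries.coeff k B) *
              (χ (cyclotomicGenerator p : ZMod (p ^ m)) - 1) ^ k)
            (algebraMap ℚ_[p] ℂ_[p] (a⁻¹ ^ m * (p : ℚ_[p])⁻¹) *
              (∑ t : ZMod p, ε t *
                χ (1 + ((t.val : ℕ) : ZMod (p ^ m)) * ((p : ZMod (p ^ m)) ^ (m - 1)))) *
              ratTwistedSymbolSum f χ)) →
      ∀ D : W.SelmerDualData κ γ,
        ∃ g ∈ D.charIdeal, ∃ k : ℕ,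
          iwasawaToPowerSeries p g = PowerSeries.C ((p : ℚ_[p]) ^ k) * B

/-! ### The `p = 3` case of the Hypothesis (second bullet) — appended the same session (gen 20)

The printed Hypothesis (p. 39) has a second bullet: "`E` is potentially ordinary at `p = 3` with
semistable reduction over a quadratic extension of `ℚ₃`", under which the Theorem (A)–(D) is asserted
verbatim (§1 fixes "an odd prime number `p`"; p. 53, Remark after Lemma 2.1: "If `p = 3` then there are
two complications … However, if we stick to our Hypothesis then we avoid both these problems"). The
sibling facts transcribe it for (A)+(B): `mainTheorem_three` (potentially GOOD ordinary at `3`, with the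
literal quadratic binder "some quadratic twist has a globally minimal model with good ordinary reduction
at `3`") and `mainTheorem_potMult` (potentially multiplicative, every odd `p`). The fact below is (C) at
`p = 3` on the SAME two loci with the SAME binders, the analytic branch in the same E-normalised
interpolation form as `thmC_charIdeal_dvd_tameBranch` (at `3` the tame defect is `2` on both loci —
`12/gcd(12, v_3Δ_min) = 2` on the potentially good locus, cell theorem
`Summit.….Additive.semistabilityIndex_eq_two_of_typeG_three` — so `ε` is the Legendre symbol mod `3`;
the interpolation package, the identification `B_E = ε(−1)G(ε̄)⁻¹(Ω⁺_E/Ω⁺_f)·(L_3^{an})^Δ` (the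
Gauss–Jacobi identity holds at every prime) and the robustness remark (only the unit `a` can be wrong
when `e = 2`; the `(1+T)^3 − 1` functional-equation argument excludes `a' ≠ a`) are as in the module
docstring). Flags as for the `p ≥ 5` fact. -/

/-- **Delbourgo 2002, Theorem (C) at `p = 3`** (Hypothesis, second bullet: "potentially ordinary at
`p = 3` with semistable reduction over a quadratic extension of `ℚ₃`"): for `W/ℚ` globally minimal
WITHOUT CM, additive at `3`, and EITHER potentially good ordinary in the global (G)-ordinary form with a
quadratic twist having a good ORDINARY globally minimal model at `3` (the binders of `mainTheorem_three`)
OR potentially multiplicative (`ord_3 j < 0` with a multiplicative quadratic twist, the binders of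
`mainTheorem_potMult`); `κ/γ` cyclotomic matching the variable (`γ₀ = cyclotomicGenerator 3 = 4`), `f`
the newform of `W`: for EVERY `ε` mod `3` of exact order `e` (the same `if` as at `p ≥ 5`; `= 2` on both
loci), EVERY unit `a ∈ ℚ₃` and EVERY bounded `B ∈ ℚ₃⟦T⟧` with `B(0) = a⁻¹[0]⁺_f` and the wild
interpolation at every primitive even `κ` of conductor `3^m`, `m ≥ 2`, of `3`-power order: for every
Pontryagin-dual datum `D` of `Sel_{3^∞}(E/ℚ_∞)`, `ι g = 3^k · B` for some `g ∈ char_Λ X(E/ℚ_∞)`, `k ∈ ℕ`.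
Stated with a prime variable `p` and `p = 3` so that the vocabulary is shared. Print: Theorem (C) p. 40
under the Hypothesis p. 39 (second bullet); proof §3 pp. 58–60 as for `p ≥ 5` (p. 53 Remark). Flags
`Del02-KKT-inprep`, `Del02-ThmC-GaussJacobi`, `Del02-ThmC-tuple-robustness` as for the sibling. No `_holds`.
[cite: Delbourgo2002, Theorem (C) (p. 40), Hypothesis second bullet (p. 39), p. 53 (Remark after Lemma 2.1), §3 pp. 58–60]
[cite: Delbourgo1998, §1.5–1.6, Thm. 1–2 (the analytic element)]
[cite: MazurTateTeitelbaum1986Invent, §I.8 (8.6), §I.13–I.14 (interpolation shape)] -/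
def thmC_three_charIdeal_dvd_tameBranch : Prop :=
  ∀ (W : WeierstrassCurve ℚ) [W.IsElliptic] [W.IsGloballyMinimal] (p : ℕ) [Fact p.Prime],
    p = 3 → ¬ W.HasCM →
    (¬ W.HasGoodReductionAtPrime p ∧ ¬ W.HasMultiplicativeReductionAtPrime p) →
    (((∃ (L : Type) (_ : Field L) (_ : NumberField L) (_ : IsCyclotomicExtension {p} ℚ L)
          (F : IntermediateField ℚ L),
          ∀ w : HeightOneSpectrum (𝓞 F), (p : 𝓞 F) ∈ w.asIdeal →
            (W.baseChange F).HasGoodReductionAt w ∧ (W.baseChange F).HasUnitRootAt w) ∧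
        ∃ (d : ℚ) (V : WeierstrassCurve ℚ) (_ : V.IsElliptic) (_ : V.IsGloballyMinimal)
          (C : VariableChange ℚ), d ≠ 0 ∧ C • W.quadraticTwist d = V ∧
          V.HasGoodReductionAtPrime p ∧ ¬ (p : ℤ) ∣ V.frobeniusTrace p) ∨
      (padicValRat p W.j < 0 ∧
        ∃ d : ℚ, d ≠ 0 ∧ (W.quadraticTwist d).HasMultiplicativeReductionAtPrime p)) →
    ∀ {κ : ZpExtension ℚ p} {γ : Field.absoluteGaloisGroup ℚ},
      κ.IsCyclotomic → κ.IsTopGenerator γ → IsCyclotomicVariable p γ →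
    ∀ {N : ℕ} [NeZero N] (f : CuspForm (Gamma0 N) 2), IsNewformOf W f →
    ∀ (ε : DirichletCharacter ℂ_[p] p) (a : ℚ_[p]) (B : PowerSeries ℚ_[p]),
      orderOf ε = (if padicValRat p W.j < 0 then 2
        else 12 / Nat.gcd 12 (padicValInt p W.minimalDiscriminantInt)) →
      ‖a‖ = 1 →
      (∃ C : ℝ, ∀ n : ℕ, ‖PowerSeries.coeff n B‖ ≤ C) →
      PowerSeries.constantCoeff B = a⁻¹ * (ratPlusSymbol f 0 : ℚ_[p]) →
      (∀ (m : ℕ), 2 ≤ m → ∀ χ : DirichletCharacter ℂ_[p] (p ^ m), χ.IsPrimitive → χ.Even →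
        (∃ j : ℕ, orderOf χ = p ^ j) →
          HasSum (fun k : ℕ ↦ algebraMap ℚ_[p] ℂ_[p] (PowerSeries.coeff k B) *
              (χ (cyclotomicGenerator p : ZMod (p ^ m)) - 1) ^ k)
            (algebraMap ℚ_[p] ℂ_[p] (a⁻¹ ^ m * (p : ℚ_[p])⁻¹) *
              (∑ t : ZMod p, ε t *
                χ (1 + ((t.val : ℕ) : ZMod (p ^ m)) * ((p : ZMod (p ^ m)) ^ (m - 1)))) *
              ratTwistedSymbolSum f χ)) →
      ∀ D : W.SelmerDualData κ γ,
        ∃ g ∈ D.charIdeal, ∃ k : ℕ,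
          iwasawaToPowerSeries p g = PowerSeries.C ((p : ℚ_[p]) ^ k) * B

end Literature.NumberTheory.EllipticCurves.Delbourgo2002

end
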